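/-
Copyright (c) 2026 the pub-hodgecm-mathlib formalisation cell (harness21).  Prover seat hodgecm-mathlib-F0P2-p01 (g11), programme P2,
«THE OUTPUT ADAPTER OF ROAD Θ-GEN-P4» (desk CENSUS-OCCGEN-B2 §2: (Ta) ∘ (Tf) at the pin frame), 2026-09-01.
KERNEL module: THEOREMS ONLY (no definition, no named fact, no `sorry`, no instance, no notation).
-/
import Summits.HodgeConjecture.HodgeConjecture.Theorems.F0P2sThetaOccursInFrameTransport  -- ★ p844284 (Tf) frame change of the clause
import Summits.HodgeConjecture.HodgeConjecture.Theorems.F0P2sThetaOccursInArchTransport   -- ★ p844299 (Ta) arch-frame transport of the clause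
import Summits.HodgeConjecture.HodgeCM.Model.LiuDictionaryPin                              -- ★ `ιVE`, `frameD`, `frameG`, `frame_congr`
import Summits.HodgeConjecture.HodgeCM.Model.GSAdaptedFrame                                -- ★ `coe_finFrameCongr`
import HarnessLib

/-!
# FLOOR-0 P2 · THE OUTPUT ADAPTER OF ROAD Θ-GEN-P4: the engine's `∃ θ`-clause AT THE PIN FRAME `(frameD V, frameG V, ιVE V)` with values in
# `holCotForms (archFactorOf F V)` ⟹ the letter's `∃ θ`-clause at ANY pinned frame `(e₁, dV, g, ιV)` with values in `cohForms [cmArchSection T, cmCompactFactor T]`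

Cell hodgecm-mathlib (D-0151), FLOOR 0; crux item H413 = stmt-HodgeConjecture-24833 (route `HCCMUnconditional`, no route verbs); programme P2, the
OCC♭-GEN pay-down line of OCC♭∀ (`Cruxes/H413/Lines/F0_P2OccFlatGeneral.lean`, ONE letter Θ-OCC-GEN `StubThetaOccursInGen`).  Desk F0P2-plan (g12)'s
CENSUS-OCCGEN-B2 §2 composition order «… ↦ (E) at a′ ↦ (Ta) ↦ (Tf) ↦ pull back along `lineClassTransport_equiv` ↦ Θ-OCC-GEN at `(a, χ)`».  THIS
FILE is the sorry-free composite (Ta) ∘ (Tf) — the OUTPUT ADAPTER — for an ARBITRARY pin `(F : HodgeCM.CMField, V : HermSpace3 F ι₁)` (the ENGINE-GEN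
hand instantiates `F := cmFieldOf L = ⟨L⟩`, `V := hermSpace3Of L ι H T hT hpos` of ★ `F0P2OccGenCotangentOfOccursIn`, where `K F = L`, `Hm V = H` by `rfl`):
* input = the `∃ θ`-clause at the PIN FRAME `(frameD V, frameG V, ιVE V)` of `Hm V` (★ `frame_congr`, ★ `coe_finFrameCongr`), splitting family
  `isCompatible_chiSplittingLine (K F) e₁ (frameD V) … (toHeckeCharacter μ) …` (DEFINITIONALLY the engine's `hsChiD ⟨K F⟩ e₁ (frameD V) … (toHeckeCharacter μ) …`:
  `sChiD` unfolds to `chiSplittingLine`), values in `CohFormsCarriers.holCotForms (archFactorOf F V)`, equivariance `θ (ρ k w) = rightRep F V k (θ w)` —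
  the conclusion shape of ★ `ThetaJunction.exists_holTheta_atLine_of_inputs`;
* output = the `∃ θ`-clause of `StubThetaOccursInGen` at ANY pinned frame `(e₁, dV, hdV, hdV0, g, hg, ιV, hιV)` of `Hm V` and ANY Sylvester frame `(T, hT)`:
  values in `cohForms … (cmArchSection (K F) ι₁ (Hm V) T hT) (cmCompactFactor …)`, equivariance `θ (rhoAtLine … ιV a χ k w) = fun x ↦ θ w (x * k_𝔸)`.
The line is the engine's `a` on both sides; ★ R3 `F0P2sThetaOccursInLineTransport` (p844221) then moves `a′ ↦ a`.
THEOREMS ONLY; `--supports stmt-HodgeConjecture-24833`.  HONEST LABEL: HC_CM is proved only modulo the printed citations until rung 0 closes; this file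
closes NO print letter — the ENGINE's INPUTS (ORIENT-GEN, χN-GEN of the census) remain the open content.

## References
* [Liu2021] Y. Liu, *Fourier–Jacobi cycles and arithmetic relative trace formula*, Camb. J. Math. 9 (2021) = arXiv:2102.11518, Prop. 4.13 («Conversely»
  l. 2145–2149); Def. 4.11 (l. 2092–2096); App. D §D.1 Steps 2–3.
* [GelbartRogawski1991] S. Gelbart, J. Rogawski, Invent. Math. 105 (1991), §3.1 Prop. 3.1.1 p. 455; Remark p. 457 L4–13.
* [BorelJacquet1979] A. Borel, H. Jacquet, PSPM 33.1 (1979), §4.1, §4.2.  [BorelWallach2000] VII 2.10.  [PlatonovRapinchuk1994] §2.3, §5.1.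
-/

set_option autoImplicit false

-- the mandated namespace has the single-problem summit's repeated segment (`HodgeConjecture.HodgeConjecture`)
set_option linter.dupNamespace false

noncomputable section

open NumberField IsDedekindDomain MulAction
open scoped Matrix ComplexOrder Classical

namespace Summit.HodgeConjecture.HodgeConjecture.Cruxes.H413.F0P2sThetaOccursInOutputAdapter

open Literature.NumberTheory.Automorphic Literature.NumberTheory.Automorphic.UnitaryGroup
open Literature.NumberTheory.Automorphic.UnitaryGroup.CotangentForms
open Literature.NumberTheory.Automorphic.IdeleClassGroup
open Literature.NumberTheory.Automorphic.Liu2021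
open Literature.NumberTheory.Automorphic.Liu2021.Def411WeilCarriers
open Literature.NumberTheory.Automorphic.Liu2021.Def411WeilCarriersDoubling
open Literature.NumberTheory.GelbartRogawski1991 Literature.NumberTheory.GelbartRogawski1991.UnitaryDualPair
open Literature.RepresentationTheory.Liu2021
open Literature.Geometry.ComplexHyperbolic
open Summit.HodgeConjecture.HodgeConjecture.Cruxes.H413
open Summit.HodgeConjecture.HodgeConjecture.Cruxes.H413.F0P2sThetaOccursInFrameTransport
open Summit.HodgeConjecture.HodgeConjecture.Cruxes.H413.F0P2sThetaOccursInArchTransport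
open HodgeCM.Model

variable (F : HodgeCM.CMField) {ι₁ : F →+* ℂ} (V : HodgeCM.HermSpace3 F ι₁) (T : GL (Fin 3) ℂ)
  (hT : (T : Matrix (Fin 3) (Fin 3) ℂ)ᴴ * (HodgeCM.HermSpace3.Hm V).map ι₁ * (T : Matrix (Fin 3) (Fin 3) ℂ) = BallModel.J)
  {n' : ℕ} (e₁ : Fin 3 × Fin 1 ≃ Fin n')
  (dV : Fin 3 → HodgeCM.CMField.K F) (hdV : ∀ i, IsCMField.complexConj (HodgeCM.CMField.K F) (dV i) = dV i) (hdV0 : ∀ i, dV i ≠ 0)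
  (g : GL (Fin 3) (HodgeCM.CMField.K F))
  (hg : ((g : Matrix (Fin 3) (Fin 3) (HodgeCM.CMField.K F)).map (cmConjRingHom (HodgeCM.CMField.K F)))ᵀ * HodgeCM.HermSpace3.Hm V *
      (g : Matrix (Fin 3) (Fin 3) (HodgeCM.CMField.K F)) = Matrix.diagonal dV)
  (ιV : finAdelic (↥(maximalRealSubfield (HodgeCM.CMField.K F))) (HodgeCM.CMField.K F) (IsCMField.complexConj (HodgeCM.CMField.K F)) 3
      (HodgeCM.HermSpace3.Hm V) →*
    finAdelic (↥(maximalRealSubfield (HodgeCM.CMField.K F))) (HodgeCM.CMField.K F) (IsCMField.complexConj (HodgeCM.CMField.K F)) 3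
      (Matrix.diagonal dV))
  (hιV : ∀ k, ((ιV k : finAdelic (↥(maximalRealSubfield (HodgeCM.CMField.K F))) (HodgeCM.CMField.K F)
        (IsCMField.complexConj (HodgeCM.CMField.K F)) 3 (Matrix.diagonal dV)) : GL (Fin 3) (FiniteAdeleRing (𝓞 (HodgeCM.CMField.K F)) (HodgeCM.CMField.K F))) =
      (toFinAdeleGL (HodgeCM.CMField.K F) 3 g)⁻¹ * (k : GL (Fin 3) (FiniteAdeleRing (𝓞 (HodgeCM.CMField.K F)) (HodgeCM.CMField.K F))) *
        toFinAdeleGL (HodgeCM.CMField.K F) 3 g)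
  (μ : Literature.NumberTheory.Automorphic.IdeleClassGroup (HodgeCM.CMField.K F) →ₜ* Circle) (hμ : IsConjugateSymplectic (HodgeCM.CMField.K F) μ)
  (a : (↥(maximalRealSubfield (HodgeCM.CMField.K F)))ˣ)
  (χ : Chi (↥(maximalRealSubfield (HodgeCM.CMField.K F))) (HodgeCM.CMField.K F) (IsCMField.complexConj (HodgeCM.CMField.K F)))

include hT hg hιV in
set_option synthInstance.maxHeartbeats 400000 in
set_option maxHeartbeats 4000000 in
/-- **THE OUTPUT ADAPTER OF ROAD Θ-GEN-P4.**  For a pin `(F, V)`, a Sylvester frame `(T, hT)` of `Hm V` at `ι₁`, a conjugate-symplectic `μ`, a line `a` and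
`χ ∈ Chi`: if the `∃ θ`-clause holds at the PIN FRAME `(frameD V, frameG V, ιVE V)` with values in `holCotForms (archFactorOf F V)` and equivariance spelled
with `rightRep F V` (the conclusion shape of ★ `ThetaJunction.exists_holTheta_atLine_of_inputs`, its `hsChiD` splitting family being definitionally
`isCompatible_chiSplittingLine …`), then it holds at EVERY pinned diagonal frame `(e₁, dV, hdV, hdV0, g, hg, ιV, hιV)` of `Hm V` with values in
`cohForms … (cmArchSection (K F) ι₁ (Hm V) T hT) (cmCompactFactor …)` and the letter's equivariance — (Ta) ★ `occursClause_cohForms_frame_of_archFactorOf`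
then (Tf) ★ `thetaOccursInClause_of_frame_change` along `frame_congr V` ∕ `coe_finFrameCongr`.
[cite: Liu2021, Prop. 4.13 («Conversely» l. 2145–2149); Def. 4.11 (l. 2092–2096)] [cite: GelbartRogawski1991, §3.1 Prop. 3.1.1 p. 455; Remark p. 457 L4–13]
[cite: BorelJacquet1979, §4.1, §4.2] [cite: PlatonovRapinchuk1994, §2.3, §5.1] -/
theorem thetaOccursInClause_of_pinFrame_archFactorOf
    (hE : ∃ θ : omegaAtLine (↥(maximalRealSubfield (HodgeCM.CMField.K F))) (HodgeCM.CMField.K F) (IsCMField.complexConj (HodgeCM.CMField.K F)) 3 e₁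
          (Matrix.diagonal (frameD V)) (complexConj_imagUnit (HodgeCM.CMField.K F)) (imagUnit_ne_zero (HodgeCM.CMField.K F))
          (imagUnit_mul_self (HodgeCM.CMField.K F)) (realDiagonal_isSymm (HodgeCM.CMField.K F) (frameD V) (frameD_real V))
          (isUnit_det_realDiagonal (HodgeCM.CMField.K F) (frameD V) (frameD_real V) (frameD_ne V))
          (realDiagonal_map (HodgeCM.CMField.K F) (frameD V) (frameD_real V)).symm
          (fun b => isCompatible_chiSplittingLine (HodgeCM.CMField.K F) e₁ (frameD V) (frameD_real V) (frameD_ne V)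
            (toHeckeCharacter (HodgeCM.CMField.K F) μ) (isUnitary_toHeckeCharacter (HodgeCM.CMField.K F) μ)
            ((isOscillatorChar_toHeckeCharacter_iff μ).mpr hμ)
            (TW (↥(maximalRealSubfield (HodgeCM.CMField.K F))) b) (isSymm_TW (↥(maximalRealSubfield (HodgeCM.CMField.K F))) b)
            (isUnit_det_TW (↥(maximalRealSubfield (HodgeCM.CMField.K F))) b) (JW (↥(maximalRealSubfield (HodgeCM.CMField.K F))) (HodgeCM.CMField.K F) b)
            (JW_eq (↥(maximalRealSubfield (HodgeCM.CMField.K F))) (HodgeCM.CMField.K F) b)) a χ →ₗ[ℂ]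
        ((CohFormsCarriers.adelicDatum F V).Adelic → (Fin 2 → ℂ)),
      θ ≠ 0 ∧ (∀ w, θ w ∈ CohFormsCarriers.holCotForms (CohFormsCarriers.archFactorOf F V)) ∧
        ∀ (k : ↥(HodgeCM.HermSpace3.adelicFin V)) (w),
          θ (rhoAtLine (↥(maximalRealSubfield (HodgeCM.CMField.K F))) (HodgeCM.CMField.K F) (IsCMField.complexConj (HodgeCM.CMField.K F)) 3 e₁
              (Matrix.diagonal (frameD V)) (complexConj_imagUnit (HodgeCM.CMField.K F)) (imagUnit_ne_zero (HodgeCM.CMField.K F))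
              (imagUnit_mul_self (HodgeCM.CMField.K F)) (realDiagonal_isSymm (HodgeCM.CMField.K F) (frameD V) (frameD_real V))
              (isUnit_det_realDiagonal (HodgeCM.CMField.K F) (frameD V) (frameD_real V) (frameD_ne V))
              (realDiagonal_map (HodgeCM.CMField.K F) (frameD V) (frameD_real V)).symm
              (fun b => isCompatible_chiSplittingLine (HodgeCM.CMField.K F) e₁ (frameD V) (frameD_real V) (frameD_ne V)
                (toHeckeCharacter (HodgeCM.CMField.K F) μ) (isUnitary_toHeckeCharacter (HodgeCM.CMField.K F) μ)
                ((isOscillatorChar_toHeckeCharacter_iff μ).mpr hμ)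
                (TW (↥(maximalRealSubfield (HodgeCM.CMField.K F))) b) (isSymm_TW (↥(maximalRealSubfield (HodgeCM.CMField.K F))) b)
                (isUnit_det_TW (↥(maximalRealSubfield (HodgeCM.CMField.K F))) b) (JW (↥(maximalRealSubfield (HodgeCM.CMField.K F))) (HodgeCM.CMField.K F) b)
                (JW_eq (↥(maximalRealSubfield (HodgeCM.CMField.K F))) (HodgeCM.CMField.K F) b)) (ιVE V) a χ k w) =
            CohFormsCarriers.rightRep F V k (θ w)) :
    ∃ θ : omegaAtLine (↥(maximalRealSubfield (HodgeCM.CMField.K F))) (HodgeCM.CMField.K F) (IsCMField.complexConj (HodgeCM.CMField.K F)) 3 e₁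
          (Matrix.diagonal dV) (complexConj_imagUnit (HodgeCM.CMField.K F)) (imagUnit_ne_zero (HodgeCM.CMField.K F))
          (imagUnit_mul_self (HodgeCM.CMField.K F)) (realDiagonal_isSymm (HodgeCM.CMField.K F) dV hdV)
          (isUnit_det_realDiagonal (HodgeCM.CMField.K F) dV hdV hdV0) (realDiagonal_map (HodgeCM.CMField.K F) dV hdV).symm
          (fun b => isCompatible_chiSplittingLine (HodgeCM.CMField.K F) e₁ dV hdV hdV0
            (toHeckeCharacter (HodgeCM.CMField.K F) μ) (isUnitary_toHeckeCharacter (HodgeCM.CMField.K F) μ)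
            ((isOscillatorChar_toHeckeCharacter_iff μ).mpr hμ)
            (TW (↥(maximalRealSubfield (HodgeCM.CMField.K F))) b) (isSymm_TW (↥(maximalRealSubfield (HodgeCM.CMField.K F))) b)
            (isUnit_det_TW (↥(maximalRealSubfield (HodgeCM.CMField.K F))) b) (JW (↥(maximalRealSubfield (HodgeCM.CMField.K F))) (HodgeCM.CMField.K F) b)
            (JW_eq (↥(maximalRealSubfield (HodgeCM.CMField.K F))) (HodgeCM.CMField.K F) b)) a χ →ₗ[ℂ]
        ((CohFormsCarriers.adelicDatum F V).Adelic → (Fin 2 → ℂ)),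
      θ ≠ 0 ∧
        (∀ w, θ w ∈ cohForms (↥(maximalRealSubfield (HodgeCM.CMField.K F))) (HodgeCM.CMField.K F) (IsCMField.complexConj (HodgeCM.CMField.K F)) 3
          (HodgeCM.HermSpace3.Hm V) (cmArchSection (HodgeCM.CMField.K F) ι₁ (HodgeCM.HermSpace3.Hm V) T hT)
          (cmCompactFactor (HodgeCM.CMField.K F) ι₁ (HodgeCM.HermSpace3.Hm V) T hT)) ∧
        ∀ (k : ↥(HodgeCM.HermSpace3.adelicFin V)) (w),
          θ (rhoAtLine (↥(maximalRealSubfield (HodgeCM.CMField.K F))) (HodgeCM.CMField.K F) (IsCMField.complexConj (HodgeCM.CMField.K F)) 3 e₁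
              (Matrix.diagonal dV) (complexConj_imagUnit (HodgeCM.CMField.K F)) (imagUnit_ne_zero (HodgeCM.CMField.K F))
              (imagUnit_mul_self (HodgeCM.CMField.K F)) (realDiagonal_isSymm (HodgeCM.CMField.K F) dV hdV)
              (isUnit_det_realDiagonal (HodgeCM.CMField.K F) dV hdV hdV0) (realDiagonal_map (HodgeCM.CMField.K F) dV hdV).symm
              (fun b => isCompatible_chiSplittingLine (HodgeCM.CMField.K F) e₁ dV hdV hdV0
                (toHeckeCharacter (HodgeCM.CMField.K F) μ) (isUnitary_toHeckeCharacter (HodgeCM.CMField.K F) μ)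
                ((isOscillatorChar_toHeckeCharacter_iff μ).mpr hμ)
                (TW (↥(maximalRealSubfield (HodgeCM.CMField.K F))) b) (isSymm_TW (↥(maximalRealSubfield (HodgeCM.CMField.K F))) b)
                (isUnit_det_TW (↥(maximalRealSubfield (HodgeCM.CMField.K F))) b) (JW (↥(maximalRealSubfield (HodgeCM.CMField.K F))) (HodgeCM.CMField.K F) b)
                (JW_eq (↥(maximalRealSubfield (HodgeCM.CMField.K F))) (HodgeCM.CMField.K F) b)) ιV a χ k w) =
            fun x => θ w (x * finAdelicToAdelic (↥(maximalRealSubfield (HodgeCM.CMField.K F))) (HodgeCM.CMField.K F)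
              (IsCMField.complexConj (HodgeCM.CMField.K F)) 3 (HodgeCM.HermSpace3.Hm V) k) := by
  -- (Ta): values `holCotForms (archFactorOf F V)` ↦ `cohForms [T]`, at the pin frame, for `σ := ρ(a,χ)[frameD V, ιVE V]`
  have h1 := occursClause_cohForms_frame_of_archFactorOf F V T hT _ hE
  -- (Tf): pin frame `(frameD V, frameG V, ιVE V)` ↦ `(dV, g, ιV)`
  exact thetaOccursInClause_of_frame_change (HodgeCM.CMField.K F) 3 (HodgeCM.HermSpace3.Hm V) e₁ dV hdV hdV0 g hg ιV hιV
    (frameD V) (frameD_real V) (frameD_ne V) (frameG V) (frame_congr V) (ιVE V)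
    (fun k => coe_finFrameCongr (HodgeCM.CMField.K F) (HodgeCM.HermSpace3.Hm V) (frameG V) (frameD V) (frame_congr V) k) μ hμ a χ _ h1

end Summit.HodgeConjecture.HodgeConjecture.Cruxes.H413.F0P2sThetaOccursInOutputAdapter

end
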